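import Literature.NumberTheory.EllipticCurves.PAdicLFunctionTameMinusBirchMeasureProofs
import Literature.NumberTheory.EllipticCurves.PAdicLFunctionTameBirchTransformProofs
import HarnessLib

/-!
# Birch's lemma for the transforms, ODD twisting relation: `L_p(g, χ(p)α, T) = C(c)·(1+T)^{−f_m}·L⁻_p(f, α, χ, T)` from
# `[x]⁺_g = c · Σ_b χ(b) [x + b/m]⁻_f` (PROOFS ONLY)

`Proofs` companion (theorems only; no definition, no named fact) of `PAdicLFunctionTameMinus` and the minus twin of
`PAdicLFunctionTameBirchTransformProofs` (`padicLFunction_twist_eq_of_birch`, Mazur–Tate–Teitelbaum §I.8–§I.13; Matsuno 2000 §2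
p. 84), proved word for word with the `χ`-weighted MINUS tame measure (`msdMeasure_twist_eq_sum_msdMeasureTameMinus`,
`sum_filter_weighted_msdMeasureTameMinus_succ`, `exists_norm_weighted_msdMeasureTameMinus_le`) in the tree's generic translation
lemma `tendsto_riemannSum_translate`:

* `padicLRiemannSum_twist_eq_minus` — the Riemann sums of `L_p(g, χ(p)α)` are `c` times the TRANSLATED weighted minus tame sums;
* `padicLCoeff_twist_eq_minus` — `[T^k] L_p(g, χ(p)α) = c · Σ_{i≤k} (−f_m choose k−i) · [T^i] L⁻_p(f, α, χ)`;
* **`padicLFunction_twist_eq_of_birch_odd`** — `L_p(g, χ(p)α, T) = C(c) · (1+T)^{−f_m} · L⁻_p(f, α, χ, T)` in `ℚ_p⟦T⟧` under the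
  symbol-level relation `hB : ∀ x, [x]⁺_g = c · Σ_{b mod m} χ(b) [x + b/m]⁻_f` (the shape of
  `exists_rat_forall_ratPlusSymbol_charTwist_eq_of_odd` for an odd quadratic `χ` of conductor `m`, `g = f ⊗ χ`).

References: B. Mazur, J. Tate, J. Teitelbaum, Invent. Math. 84 (1986), §I.8–§I.13 [MazurTateTeitelbaum1986Invent]; K. Matsuno,
J. Number Theory 84 (2000), §2 (p. 84), Lemma 3.3 [Matsuno2000].
-/

noncomputable section

open scoped MatrixGroups ModularForm

open CongruenceSubgroup Filter Topology PowerSeries Literature.NumberTheory.EllipticCurves.ModularForms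
  Literature.NumberTheory.EllipticCurves.GreenbergVatsal2000

namespace Literature.NumberTheory.EllipticCurves

section BirchTransform

variable {N N' : ℕ} [NeZero N] [NeZero N'] (f : CuspForm (Gamma0 N) 2) (g : CuspForm (Gamma0 N') 2)
  {p : ℕ} [Fact p.Prime] {m : ℕ} [NeZero m]

omit [NeZero N'] in
/-- **The Riemann sums of the twist are `c` times the TRANSLATED weighted tame sums**: under `hB`, for `m ≡ ω(m) γ^{f_m}`
(`teich`, `hc`), `padicLRiemannSum g (χ(p)α) k n = c · Σ_η Σ_s ν_χ((ω(m)γ^{f_m})·(ηγˢ)) C(s,k)`, `ν_χ(x) = Σ_b χ(b) μ_{f,α,m}(x × {b})`.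
[cite: MazurTateTeitelbaum1986Invent, §I.8–I.13 (pp. 10–19)] -/
theorem padicLRiemannSum_twist_eq_minus (hmp : m.Coprime p) (χ : MulChar (ZMod m) ℚ) (hχp : χ (p : ZMod m) ^ 2 = 1) {c : ℚ}
    (hB : ∀ x : ℚ, ratPlusSymbol g x = c * ∑ b : ZMod m, χ b * ratMinusSymbol f (x + (b.val : ℚ) / m))
    (α : ℚ_[p]) {teich : rootsOfUnity (torsionOrder p) ℤ_[p]} {e : ℤ_[p]}
    (hc : ∀ n : ℕ, PadicInt.toZModPow (n + cyclotomicExponent p) ((teich : ℤ_[p]ˣ) : ℤ_[p]) *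
        (cyclotomicGenerator p : ZMod (p ^ (n + cyclotomicExponent p))) ^ (PadicInt.toZModPow n e).val =
          (m : ZMod (p ^ (n + cyclotomicExponent p)))) (k n : ℕ) :
    padicLRiemannSum g (((χ (p : ZMod m) : ℚ) : ℚ_[p]) * α) k n =
      (c : ℚ_[p]) * ∑ᶠ zz : rootsOfUnity (torsionOrder p) ℤ_[p], ∑ s : ZMod (p ^ n),
        (fun (n : ℕ) (a : ZMod (p ^ n)) ↦
            ∑ b : ZMod m, (χ.ringHomComp (Rat.castHom ℚ_[p])) b * msdMeasureTameMinus f m α n a b)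
          (n + cyclotomicExponent p)
          ((PadicInt.toZModPow (n + cyclotomicExponent p) ((teich : ℤ_[p]ˣ) : ℤ_[p]) *
              (cyclotomicGenerator p : ZMod (p ^ (n + cyclotomicExponent p))) ^ (PadicInt.toZModPow n e).val) *
            (PadicInt.toZModPow (n + cyclotomicExponent p) ((zz : ℤ_[p]ˣ) : ℤ_[p]) *
              (cyclotomicGenerator p : ZMod (p ^ (n + cyclotomicExponent p))) ^ s.val)) *
          ((s.val.choose k : ℕ) : ℚ_[p]) := by
  classical
  haveI := neZero_torsionOrder p
  haveI := Fintype.ofFinite (rootsOfUnity (torsionOrder p) ℤ_[p])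
  unfold padicLRiemannSum
  rw [finsum_eq_sum_of_fintype, finsum_eq_sum_of_fintype, Finset.mul_sum]
  refine Finset.sum_congr rfl fun zz _ ↦ ?_
  rw [Finset.mul_sum]
  refine Finset.sum_congr rfl fun s _ ↦ ?_
  rw [msdMeasure_twist_eq_sum_msdMeasureTameMinus f g hmp χ hχp hB α, hc n, mul_comm (m : ZMod (p ^ (n + cyclotomicExponent p)))]
  simp only [MulChar.ringHomComp_apply, eq_ratCast]
  ring

omit [NeZero N'] in
/-- **Birch's lemma for the coefficients**: under `hB` and the convergence hypotheses for `f` (rational normalised newform of level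
prime to `p`, `(m,p) = 1`, `α` the unit root), `[T^k] L_p(g, χ(p)α) = c · Σ_{i≤k} (−f_m choose k−i) · [T^i] L_p(f, α, χ)`,
`f_m = frobeniusExponent p m` (`tendsto_riemannSum_translate` for the `χ`-weighted tame measure translated by `m`).
[cite: MazurTateTeitelbaum1986Invent, §I.8–I.13 (pp. 10–19)] [cite: Matsuno2000, §2 (p. 84)] -/
theorem padicLCoeff_twist_eq_minus (hf : IsNewform0 f) (hQ : coeffField f = ⊥) (hpN : ¬ p ∣ N) (hmp : m.Coprime p)
    {ap : ℤ} (hap : cuspCoeff f p = ap) {α : ℚ_[p]} (hα : α ^ 2 - ap * α + p = 0) (hαu : ‖α‖ = 1)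
    (χ : MulChar (ZMod m) ℚ) (hχp : χ (p : ZMod m) ^ 2 = 1) {c : ℚ}
    (hB : ∀ x : ℚ, ratPlusSymbol g x = c * ∑ b : ZMod m, χ b * ratMinusSymbol f (x + (b.val : ℚ) / m)) (k : ℕ) :
    padicLCoeff g (((χ (p : ZMod m) : ℚ) : ℚ_[p]) * α) k =
      (c : ℚ_[p]) * ∑ i ∈ Finset.range (k + 1),
        algebraMap ℤ_[p] ℚ_[p] (Ring.choose (-frobeniusExponent p (m : ℤ_[p])) (k - i)) *
          padicLCoeffTameMinus f m α (χ.ringHomComp (Rat.castHom ℚ_[p])) i := by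
  classical
  set χp : DirichletCharacter ℚ_[p] m := χ.ringHomComp (Rat.castHom ℚ_[p]) with hχp_def
  have hα0 : α ≠ 0 := norm_ne_zero_iff.mp (by rw [hαu]; exact one_ne_zero)
  have hdist := sum_filter_weighted_msdMeasureTameMinus_succ f hf (ratCast_ratMinusSymbol f hf hQ) hpN hmp
    hap hα0 hα χp
  obtain ⟨C, hC⟩ := exists_norm_weighted_msdMeasureTameMinus_le f
    (exists_nsmul_modularSymbol_mem_periodLattice_of_isNewform0 hf hQ) hαu χp
  obtain ⟨teich, hc⟩ := exists_teichmuller_frobeniusExponent p hmp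
  have hRSdef : ∀ k n : ℕ, padicLRiemannSumTameMinus f m α χp k n =
      ∑ᶠ zz : rootsOfUnity (torsionOrder p) ℤ_[p], ∑ s : ZMod (p ^ n),
        (fun (n : ℕ) (a : ZMod (p ^ n)) ↦ ∑ b : ZMod m, χp b * msdMeasureTameMinus f m α n a b)
          (n + cyclotomicExponent p)
          (PadicInt.toZModPow (n + cyclotomicExponent p) ((zz : ℤ_[p]ˣ) : ℤ_[p]) *
            (cyclotomicGenerator p : ZMod (p ^ (n + cyclotomicExponent p))) ^ s.val) *
          (s.val.choose k : ℚ_[p]) :=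
    fun k n ↦ padicLRiemannSumTameMinus_eq_sum_weighted f α χp k n
  set RSz : ℕ → ℕ → ℚ_[p] := fun k n ↦ ∑ᶠ zz : rootsOfUnity (torsionOrder p) ℤ_[p], ∑ s : ZMod (p ^ n),
        (fun (n : ℕ) (a : ZMod (p ^ n)) ↦ ∑ b : ZMod m, χp b * msdMeasureTameMinus f m α n a b)
          (n + cyclotomicExponent p)
          ((PadicInt.toZModPow (n + cyclotomicExponent p) ((teich : ℤ_[p]ˣ) : ℤ_[p]) *
              (cyclotomicGenerator p : ZMod (p ^ (n + cyclotomicExponent p))) ^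
                (PadicInt.toZModPow n (frobeniusExponent p (m : ℤ_[p]))).val) *
            (PadicInt.toZModPow (n + cyclotomicExponent p) ((zz : ℤ_[p]ˣ) : ℤ_[p]) *
              (cyclotomicGenerator p : ZMod (p ^ (n + cyclotomicExponent p))) ^ s.val)) *
          ((s.val.choose k : ℕ) : ℚ_[p]) with hRSz_def
  have hRSz : ∀ k n : ℕ, RSz k n = ∑ᶠ zz : rootsOfUnity (torsionOrder p) ℤ_[p], ∑ s : ZMod (p ^ n),
        (fun (n : ℕ) (a : ZMod (p ^ n)) ↦ ∑ b : ZMod m, χp b * msdMeasureTameMinus f m α n a b)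
          (n + cyclotomicExponent p)
          ((PadicInt.toZModPow (n + cyclotomicExponent p) ((teich : ℤ_[p]ˣ) : ℤ_[p]) *
              (cyclotomicGenerator p : ZMod (p ^ (n + cyclotomicExponent p))) ^
                (PadicInt.toZModPow n (frobeniusExponent p (m : ℤ_[p]))).val) *
            (PadicInt.toZModPow (n + cyclotomicExponent p) ((zz : ℤ_[p]ˣ) : ℤ_[p]) *
              (cyclotomicGenerator p : ZMod (p ^ (n + cyclotomicExponent p))) ^ s.val)) *
          ((s.val.choose k : ℕ) : ℚ_[p]) := fun k n ↦ by rw [hRSz_def]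
  have hlim := tendsto_riemannSum_translate hdist hC hRSdef hRSz k
  have hRS : ∀ n, padicLRiemannSum g (((χ (p : ZMod m) : ℚ) : ℚ_[p]) * α) k n = (c : ℚ_[p]) * RSz k n := fun n ↦ by
    rw [hRSz_def]
    exact padicLRiemannSum_twist_eq_minus f g hmp χ hχp hB α hc k n
  have hT : Tendsto (padicLRiemannSum g (((χ (p : ZMod m) : ℚ) : ℚ_[p]) * α) k) atTop
      (𝓝 ((c : ℚ_[p]) * ∑ i ∈ Finset.range (k + 1),
        algebraMap ℤ_[p] ℚ_[p] (Ring.choose (-frobeniusExponent p (m : ℤ_[p])) (k - i)) *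
          limUnder atTop (fun n ↦ padicLRiemannSumTameMinus f m α χp i n))) := by
    refine ((hlim.const_mul (c : ℚ_[p])).congr fun n ↦ ?_)
    exact (hRS n).symm
  rw [padicLCoeff, hT.limUnder_eq]
  rfl

omit [NeZero N'] in
/-- **Birch's lemma for the transforms.** Under the symbol-level twisting relation
`hB : ∀ x, [x]⁺_g = c · Σ_{b mod m} χ(b) [x + b/m]⁺_f` (`χ` a `ℚ`-valued character mod `m`, `(m,p) = 1`, `χ(p)² = 1`) and the
standing hypotheses on `f` (rational normalised newform, `p ∤ N`, `α` the unit root):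
`L_p(g, χ(p)α, T) = C(c) · (1+T)^{−f_m} · L_p(f, α, χ, T)` in `ℚ_p⟦T⟧`, `f_m = frobeniusExponent p m` (`γ_cyc^{f_m} = ⟨m⟩`),
`(1+T)^{−f_m} = binomialSeries ℚ_p (−f_m)`. [cite: MazurTateTeitelbaum1986Invent, §I.8–I.13 (pp. 10–19)] [cite: Matsuno2000, §2 (p. 84)] -/
theorem padicLFunction_twist_eq_of_birch_odd (hf : IsNewform0 f) (hQ : coeffField f = ⊥) (hpN : ¬ p ∣ N) (hmp : m.Coprime p)
    {ap : ℤ} (hap : cuspCoeff f p = ap) {α : ℚ_[p]} (hα : α ^ 2 - ap * α + p = 0) (hαu : ‖α‖ = 1)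
    (χ : MulChar (ZMod m) ℚ) (hχp : χ (p : ZMod m) ^ 2 = 1) {c : ℚ}
    (hB : ∀ x : ℚ, ratPlusSymbol g x = c * ∑ b : ZMod m, χ b * ratMinusSymbol f (x + (b.val : ℚ) / m)) :
    padicLFunction g (((χ (p : ZMod m) : ℚ) : ℚ_[p]) * α) =
      C (c : ℚ_[p]) * PowerSeries.binomialSeries ℚ_[p] (-frobeniusExponent p (m : ℤ_[p])) *
        padicLFunctionTameMinus f m α (χ.ringHomComp (Rat.castHom ℚ_[p])) := by
  ext k
  rw [coeff_padicLFunction, padicLCoeff_twist_eq_minus f g hf hQ hpN hmp hap hα hαu χ hχp hB k, coeff_C_mul_binomialSeries_mul]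
  congr 1
  refine Finset.sum_congr rfl fun i _ ↦ ?_
  rw [coeff_padicLFunctionTameMinus]

end BirchTransform

end Literature.NumberTheory.EllipticCurves

end
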